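import Literature.NumberTheory.GaloisRepresentations.UniformizerResidueIndex
import Literature.NumberTheory.Automorphic.AdicCompletionCompact
import Literature.NumberTheory.Automorphic.UnramifiedHeckeScalars
import Literature.RingTheory.DiscreteValuationRing.AdicCompletionResidueField
import Mathlib.NumberTheory.NumberField.Completion.FinitePlace
import HarnessLib

/-!
# Norm uniformizers of `K_v` at a finite place of a number field: `[𝒪_v : ϖ𝒪_v] = N(v)`,
# `mod_{K_v}(ϖ) = N(v)⁻¹`, and `IsUniformizer ϖ ↔ v(ϖ) = exp(-1)`

Topic `NumberTheory/GaloisRepresentations`; namespace `Literature.NumberTheory.GaloisRepresentations.Ultrametric`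
with the grouping sub-namespace `AdicCompletion`. Setting: `K` a number field, `v : HeightOneSpectrum (𝓞 K)`,
`K_v = v.adicCompletion K` with Mathlib's `Valued`-induced normed-field structure (`FinitePlace.norm_def`:
`‖x‖ = N(v)^{-ord x}`), made a `NontriviallyNormedField` by `Valued.toNontriviallyNormedField` (local
instance `nontriviallyNormedField`, definitionally the registered `NormedField`) and proper by the tree's
`Literature.NumberTheory.Automorphic.properSpace_adicCompletion` (used as a local instance). Contents:

* `exists_isUniformizer` : norm uniformizers of `K_v` (`NormUniformizer.IsUniformizer`) exist;
* `integerEquiv` : the valuation ring of the NORM valuation `≃+* v.adicCompletionIntegers K`;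
  `card_residueField_eq_absNorm : #(𝒪_v/𝔪_v) = N(v)` (tree `residueFieldEquiv : 𝓞 K ⧸ v ≃+* κ(𝒪_v)`);
* **`resIndex_eq_absNorm : resIndex ϖ = N(v)`** and **`distribHaarChar_eq_inv_absNorm : mod_{K_v}(ϖ) = N(v)⁻¹`**
  for every norm uniformizer `ϖ` (Weil's `mod_K(π) = q⁻¹` at the finite places of a number field);
  `two_le_absNorm : 2 ≤ N(v)`;
* the bridge to Mathlib's uniformizers: `norm_eq_absNorm_zpow`, `isUniformizer_of_valuation_eq(_exp)`
  (`Valued.v ϖ = exp(-1) ⇒ IsUniformizer ϖ ∧ ‖ϖ‖ = N(v)⁻¹`) and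
  **`isUniformizer_iff_valuation_eq_exp : IsUniformizer ϖ ↔ Valued.v ϖ = WithZero.exp (-1)`** (the `⇒` direction
  compares with a Mathlib-uniformizer supplied by the tree's
  `Literature.NumberTheory.Automorphic.exists_valuation_eq_exp_neg_one`).

Standard: A. Weil, *Basic Number Theory* (1967), Ch. I §4, Th. 6; J. Neukirch, *Algebraic Number Theory*
(1999), Ch. II §5 [folklore]. Everything is proved (Mathlib + the imported tree files). Novelty check
(`lean search --decl`, 2026-08-18): the tree has `properSpace_adicCompletion`, `residueFieldEquiv`,
`natCard_residueField_adicCompletionIntegers`, `exists_valuation_eq_exp_neg_one`, and (today)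
`resIndex_eq_card_residueField` — all REUSED by name; the number-field
specialisations and the `IsUniformizer ↔ exp(-1)` bridge are not in the tree. Deliberately NOT here: local
integrals / matrix coefficients at `K_v`, Haar measures on `K_v³`.

## Provenance

Reproduced for the tree under the LEAN-IN-TREE rule (2026-08-18) from the pub-hodgecm cell's package file
`HodgeCM/PerL34/LocalFactors/AdicSplitFactor.lean`, first part (ll. 56–203; 13 declarations — the package's local
aliases `properSpace` / `exists_units_valuation_eq_exp_neg_one` replaced by the tree declarations they restated;
DAG-node prover #07 lineage, seat pv07 gen 2, gate run 25), statements and proofs verbatim except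
`LocalModulus.` / `DilationModel.` ↦ the tree names (namespace `…Ultrametric`), docstrings / tags; port by
seat pv07 gen 5.
-/

set_option autoImplicit false

noncomputable section

open MeasureTheory MeasureTheory.Measure Set Metric TopologicalSpace IsLocalRing NumberField IsDedekindDomain
open scoped NNReal

namespace Literature.NumberTheory.GaloisRepresentations.Ultrametric

namespace AdicCompletion

variable (K : Type) [Field K] [NumberField K] (v : HeightOneSpectrum (𝓞 K))

/-- `K_v` as a NON-TRIVIALLY normed field: Mathlib's `Valued.toNontriviallyNormedField`; its `NormedField` part
is the instance Mathlib registers on `v.adicCompletion K` (next lemma, `rfl`). [folklore] -/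
@[reducible] def nontriviallyNormedField : NontriviallyNormedField (v.adicCompletion K) :=
  Valued.toNontriviallyNormedField (v.adicCompletion K) (WithZero (Multiplicative ℤ))

/-- The `NormedField` underlying `nontriviallyNormedField` is Mathlib's registered instance. [folklore] -/
theorem nontriviallyNormedField_toNormedField :
    (nontriviallyNormedField K v).toNormedField = HeightOneSpectrum.instNormedFieldValuedAdicCompletion K v := rfl

attribute [local instance] nontriviallyNormedField

attribute [local instance] Literature.NumberTheory.Automorphic.properSpace_adicCompletion

/-- Norm uniformizers of `K_v` exist (`NormUniformizer.exists_isUniformizer`). [folklore] -/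
theorem exists_isUniformizer : ∃ ϖ : (v.adicCompletion K)ˣ, IsUniformizer ϖ :=
  Ultrametric.exists_isUniformizer

/-! ### `[𝒪_v : ϖ𝒪_v] = N(v)` -/

/-- The valuation ring of the NORM valuation of `K_v` (the ring `UniformizerResidueIndex` speaks about) IS
Mathlib's `𝒪_v = v.adicCompletionIntegers K`. [folklore] -/
def integerEquiv :
    (@Valued.integer (v.adicCompletion K) _ ℝ≥0 _ NormedField.toValued) ≃+* v.adicCompletionIntegers K where
  toFun x := ⟨x.1, (HeightOneSpectrum.mem_adicCompletionIntegers (𝓞 K) K v).mpr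
    (Valued.toNormedField.norm_le_one_iff.mp (Valued.integer.mem_iff.mp x.2))⟩
  invFun y := ⟨y.1, Valued.integer.mem_iff.mpr
    (Valued.toNormedField.norm_le_one_iff.mpr ((HeightOneSpectrum.mem_adicCompletionIntegers (𝓞 K) K v).mp y.2))⟩
  left_inv _ := rfl
  right_inv _ := rfl
  map_mul' _ _ := rfl
  map_add' _ _ := rfl

/-- `#(𝒪_v/𝔪_v) = N(v)` for the norm-valuation ring (tree `residueFieldEquiv : 𝓞 K ⧸ v ≃+* κ(𝒪_v)`).
[folklore] -/
theorem card_residueField_eq_absNorm :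
    Nat.card (ResidueField (@Valued.integer (v.adicCompletion K) _ ℝ≥0 _ NormedField.toValued)) =
      Ideal.absNorm v.asIdeal := by
  rw [Nat.card_congr (ResidueField.mapEquiv (integerEquiv K v)).toEquiv,
    HeightOneSpectrum.natCard_residueField_adicCompletionIntegers K v, Ideal.absNorm_apply,
    Submodule.cardQuot_apply]

/-- **`[𝒪_v : ϖ_v𝒪_v] = N(v)`**: the index `resIndex ϖ` of ANY norm uniformizer of `K_v` is the absolute norm
of `v`. [folklore] -/
theorem resIndex_eq_absNorm (ϖ : (v.adicCompletion K)ˣ) (hϖ : IsUniformizer ϖ) :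
    resIndex ϖ = Ideal.absNorm v.asIdeal :=
  hϖ.resIndex_eq_card_residueField.trans (card_residueField_eq_absNorm K v)

/-- **`mod_{K_v}(ϖ_v) = N(v)⁻¹`** at the finite places of a number field, as a theorem.
[cite: WeilBNT1967, Ch. I §4, Th. 6] -/
theorem distribHaarChar_eq_inv_absNorm (ϖ : (v.adicCompletion K)ˣ) (hϖ : IsUniformizer ϖ) :
    distribHaarChar (v.adicCompletion K) ϖ = ((Ideal.absNorm v.asIdeal : ℝ≥0))⁻¹ := by
  rw [← resIndex_eq_absNorm K v ϖ hϖ]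
  exact distribHaarChar_uniformizer hϖ.1.le

/-- `2 ≤ N(v)`. [folklore] -/
theorem two_le_absNorm : 2 ≤ Ideal.absNorm v.asIdeal := by
  obtain ⟨ϖ, hϖ⟩ := exists_isUniformizer K v
  rw [← resIndex_eq_absNorm K v ϖ hϖ]
  exact two_le_resIndex hϖ.1

/-! ### Mathlib's uniformizers (`Valued.v ϖ = exp (-1)`) are uniformizers in the norm sense -/

/-- `‖x‖ = N(v)ⁿ` when `Valued.v x = ↑(ofAdd n)` (`= WithZero.exp n`). [folklore] -/
theorem norm_eq_absNorm_zpow {x : v.adicCompletion K} (n : ℤ)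
    (hx : Valued.v x = ((Multiplicative.ofAdd n : Multiplicative ℤ) : WithZero (Multiplicative ℤ))) :
    ‖x‖ = ((Ideal.absNorm v.asIdeal : ℕ) : ℝ) ^ n := by
  rw [NumberField.FinitePlace.norm_def, hx, WithZeroMulInt.toNNReal_neg_apply _ WithZero.coe_ne_zero,
    WithZero.unzero_coe, toAdd_ofAdd, NNReal.coe_zpow, NNReal.coe_natCast]

/-- Every `y ∈ K_vˣ` has norm `N(v)ⁿ`, `n` = its additive valuation read off `Valued.v`. [folklore] -/
theorem norm_units_eq_absNorm_zpow (y : (v.adicCompletion K)ˣ) :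
    ‖(y : v.adicCompletion K)‖ = ((Ideal.absNorm v.asIdeal : ℕ) : ℝ) ^
      (WithZero.unzero ((Valuation.ne_zero_iff Valued.v).mpr y.ne_zero)).toAdd :=
  norm_eq_absNorm_zpow K v _ (by rw [ofAdd_toAdd, WithZero.coe_unzero])

/-- **Bridge to Mathlib's notion of uniformizer**: if `Valued.v ϖ = WithZero.exp (-1)` (`= ↑(ofAdd (-1))`;
such `ϖ` exist by `IsDedekindDomain.HeightOneSpectrum.valuation_exists_uniformizer`), then `ϖ` is a norm
uniformizer (`IsUniformizer`) and `‖ϖ‖ = N(v)⁻¹`. [folklore] -/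
theorem isUniformizer_of_valuation_eq (ϖ : (v.adicCompletion K)ˣ)
    (h : Valued.v (ϖ : v.adicCompletion K) =
      ((Multiplicative.ofAdd (-1 : ℤ) : Multiplicative ℤ) : WithZero (Multiplicative ℤ))) :
    IsUniformizer ϖ ∧ ‖(ϖ : v.adicCompletion K)‖ = (((Ideal.absNorm v.asIdeal : ℕ) : ℝ))⁻¹ := by
  have hϖ : ‖(ϖ : v.adicCompletion K)‖ = (((Ideal.absNorm v.asIdeal : ℕ) : ℝ))⁻¹ := by
    rw [norm_eq_absNorm_zpow K v (-1) h, zpow_neg, zpow_one]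
  have hN : (1 : ℝ) < ((Ideal.absNorm v.asIdeal : ℕ) : ℝ) := by
    exact_mod_cast NumberField.HeightOneSpectrum.one_lt_absNorm v
  refine ⟨⟨?_, fun y => ?_⟩, hϖ⟩
  · rw [hϖ]
    exact inv_lt_one_of_one_lt₀ hN
  · refine ⟨-(WithZero.unzero ((Valuation.ne_zero_iff Valued.v).mpr y.ne_zero)).toAdd, ?_⟩
    rw [hϖ, inv_zpow', neg_neg, norm_units_eq_absNorm_zpow K v y]

/-- The same with Mathlib's `WithZero.exp` spelling of the hypothesis. [folklore] -/
theorem isUniformizer_of_valuation_eq_exp (ϖ : (v.adicCompletion K)ˣ)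
    (h : Valued.v (ϖ : v.adicCompletion K) = WithZero.exp (-1 : ℤ)) : IsUniformizer ϖ :=
  (isUniformizer_of_valuation_eq K v ϖ h).1

/-- Hence `[𝒪_v : ϖ𝒪_v] = N(v)` and `mod(ϖ) = N(v)⁻¹` for Mathlib-uniformizers too. [folklore] -/
theorem resIndex_eq_absNorm_of_valuation_eq_exp (ϖ : (v.adicCompletion K)ˣ)
    (h : Valued.v (ϖ : v.adicCompletion K) = WithZero.exp (-1 : ℤ)) :
    resIndex ϖ = Ideal.absNorm v.asIdeal ∧
      distribHaarChar (v.adicCompletion K) ϖ = ((Ideal.absNorm v.asIdeal : ℝ≥0))⁻¹ :=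
  ⟨resIndex_eq_absNorm K v ϖ (isUniformizer_of_valuation_eq_exp K v ϖ h),
    distribHaarChar_eq_inv_absNorm K v ϖ (isUniformizer_of_valuation_eq_exp K v ϖ h)⟩

/-- **The two notions of uniformizer of `K_v` coincide**: `IsUniformizer ϖ` (norm sense) iff
`Valued.v ϖ = WithZero.exp (-1)` (Mathlib).  (`⇐` is `isUniformizer_of_valuation_eq_exp`; `⇒`: write
`‖ϖ‖ = N(v)ᵐ`, compare with a Mathlib-uniformizer `π`, `‖π‖ = N(v)⁻¹ = ‖ϖ‖ᵇ`, so `mb = -1`, and `m < 0`.)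
[folklore] -/
theorem isUniformizer_iff_valuation_eq_exp (ϖ : (v.adicCompletion K)ˣ) :
    IsUniformizer ϖ ↔ Valued.v (ϖ : v.adicCompletion K) = WithZero.exp (-1 : ℤ) := by
  refine ⟨fun hϖ => ?_, isUniformizer_of_valuation_eq_exp K v ϖ⟩
  obtain ⟨π, hπ⟩ := Literature.NumberTheory.Automorphic.exists_valuation_eq_exp_neg_one K v
  have hπn : ‖(π : v.adicCompletion K)‖ = (((Ideal.absNorm v.asIdeal : ℕ) : ℝ))⁻¹ :=
    (isUniformizer_of_valuation_eq K v π hπ).2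
  have hN : (1 : ℝ) < ((Ideal.absNorm v.asIdeal : ℕ) : ℝ) := by
    exact_mod_cast NumberField.HeightOneSpectrum.one_lt_absNorm v
  have hv0 : Valued.v (ϖ : v.adicCompletion K) ≠ 0 := (Valuation.ne_zero_iff Valued.v).mpr ϖ.ne_zero
  set m : ℤ := (WithZero.unzero hv0).toAdd with hm
  have hϖm : ‖(ϖ : v.adicCompletion K)‖ = ((Ideal.absNorm v.asIdeal : ℕ) : ℝ) ^ m :=
    norm_units_eq_absNorm_zpow K v ϖ
  obtain ⟨b, hb⟩ := hϖ.2 π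
  rw [hπn, hϖm, ← zpow_mul, ← zpow_neg_one] at hb
  have hmb : m * b = -1 := (zpow_right_injective₀ (zero_lt_one.trans hN) hN.ne' hb).symm
  have hm0 : m < 0 := by
    have := hϖ.1; rw [hϖm, zpow_lt_one_iff_right₀ hN] at this; exact this
  have hm1 : m = -1 := by
    rcases Int.eq_one_or_neg_one_of_mul_eq_neg_one hmb with h | h
    · omega
    · exact h
  rw [← WithZero.coe_unzero hv0, ← ofAdd_toAdd (WithZero.unzero hv0), ← hm, hm1]
  rfl

end AdicCompletion

end Literature.NumberTheory.GaloisRepresentations.Ultrametric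

end
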